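import Summits.BirchSwinnertonDyer.BirchSwinnertonDyer.Theorems.KolyvaginRankRigidityAtTwoSignedRefillLaw
import HarnessLib

/-!
# Crux U1 `KolyvaginBoundedDefectAtTwo` (stmt-BirchSwinnertonDyer-28083), LINE 17 `kolyvagin_swap` —
# SIGNED EIGEN-COUNTS (pure finite-group algebra toward the pen's v8.1 stub SRF `ShapeRefillAtTwo`):
# `#H_tr^{σ = s} = #H_f^{σ = s}` for a complementary Lagrangian pair under a pairing-preserving involution, and
# «`#H ≤ 2^(m+κ)` with a class of order `2^m`» ⟹ «`2^κ · H ⊆ ℤx`» for any `2`-power-torsion `H`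

Width seat `bsd-line-krr2-p2` g18 (ONE READER on LINE 17); `--supports stmt-BirchSwinnertonDyer-28083` (helper). THEOREMS ONLY, PURE
ALGEBRA: nothing here proves SRF, SWα⁗, U1, a rung or BSD. BSD is NOT proved.

## What
* `natCard_inf_ker_eq_of_lagrangian_pair` — in g13's setting (`b : L × L → ℤ/n` symmetric non-degenerate, `L = H_f ⊕ H_tr` both isotropic)
  with an additive involution `σ` preserving `b`, `H_f`, `H_tr`, and any `s : ℤ`:
  **`#(H_tr ∩ ker(σ − s)) = #(H_f ∩ ker(σ − s))`**. PROOF: `H_tr ∩ ker(σ − s) = ann_{H_tr}((σ − s) H_f)` (`σ − s` is self-adjoint;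
  perfectness of `H_f × H_tr`), so `#(H_tr ∩ ker(σ−s)) · #((σ−s)H_f) = #H_tr = #H_f = #(H_f ∩ ker(σ−s)) · #((σ−s)H_f)`. In situ (LINE 17): the
  `s`-eigen-part of the TRANSVERSE condition `𝒯_λ` at a Kolyvagin place has as many elements as that of the Kummer condition, `≤ 2^(M+1)`
  (`kummer_eigen_at_two_of_index`) — no description of `𝒯_λ` needed.
* `forall_exists_zsmul_eq_of_natCard_le_of_nsmul_eq_zero` — g13's near-core counting lemma (`forall_exists_zsmul_eq_of_natCard_le`, p673260)
  with the class `x` of order `2^m` no longer required to realise the exponent: `H` killed by `2^k`, `x ∈ H` of order `2^m`,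
  `#H ≤ 2^(m+κ)` ⟹ `∀ y ∈ H, 2^κ y ∈ ℤx`.
* `two_pow_dvd_of_zsmul_eq_zero_of_ne_zero` — if `2^k x = 0`, `2^(k−c) x ≠ 0` and `b x = 0` then `2^(k−c+1) ∣ b`;
  `zsmul_sub_zsmul_mul_eq` — `2^(c+d) y − (2^d t) x = 2^d (2^c y − t x)` (generic spelling, safe for `H¹(K, E[2^M])`).
References (locators only; no cited FACT is declared): [cite: MazurRubin2004, §1.3, §4.1 Cor. 4.1.9] [cite: MilneADT2006, Ch. I §0 (0.19)]
[cite: Howard2004HeegnerKolyvagin, §1.6].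
Design: no definitions; `Type*`-polymorphic; axioms `propext`, `Classical.choice`, `Quot.sound`.
-/

set_option autoImplicit false
-- the Theorems namespace of this sub repeats the summit name by design (D-0017 nested layout)
set_option linter.dupNamespace false

noncomputable section

open scoped Classical
open Function

namespace Summit.BirchSwinnertonDyer.BirchSwinnertonDyer.Theorems.KolyvaginAtTwo.RegularRefill

open Summit.BirchSwinnertonDyer.Rank1Residual.JET.Section6 (card_eq_card_inf_ker_mul_card_map)

variable {L : Type*} [AddCommGroup L]

section EigenCount

variable {n : ℕ} (b : L →+ L →+ ZMod n)
  (hn : ∀ x : L, n • x = 0) (hsymm : ∀ x y, b x y = b y x)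
  {Hf Htr : AddSubgroup L} (hdisj : Hf ⊓ Htr = ⊥) (hcod : Hf ⊔ Htr = ⊤)
  (hHf : ∀ x ∈ Hf, ∀ y ∈ Hf, b x y = 0) (hHtr : ∀ x ∈ Htr, ∀ y ∈ Htr, b x y = 0)
  (σ : L →+ L) (hσσ : ∀ x, σ (σ x) = x) (hσb : ∀ x y, b (σ x) (σ y) = b x y)
  (hσf : ∀ f ∈ Hf, σ f ∈ Hf) (hσt : ∀ t ∈ Htr, σ t ∈ Htr)

include hσσ hσb in
/-- `σ − s` is self-adjoint for `b`. [folklore] -/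
theorem apply_sub_smul_left (s : ℤ) (x y : L) :
    b ((σ - s • AddMonoidHom.id L) x) y = b x ((σ - s • AddMonoidHom.id L) y) := by
  simp only [AddMonoidHom.sub_apply, AddMonoidHom.smul_apply, AddMonoidHom.id_apply, map_sub, map_zsmul,
    apply_apply_eq_apply_apply b σ hσσ hσb]

include hsymm hcod hHtr hσσ hσb hσt in
/-- **`H_tr ∩ ker(σ − s) = ann_{H_tr}((σ − s) H_f)`.** [cite: MazurRubin2004, §1.3] -/
theorem inf_ker_eq_ann_map (hinj : Injective b) (s : ℤ) :
    Htr ⊓ (σ - s • AddMonoidHom.id L).ker = Htr ⊓ ⨅ a ∈ Hf.map (σ - s • AddMonoidHom.id L), (b a).ker := by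
  ext t
  rw [mem_inf_iInf_ker_iff, AddSubgroup.mem_inf, AddMonoidHom.mem_ker]
  constructor
  · rintro ⟨ht, hker⟩
    refine ⟨ht, fun a ha ↦ ?_⟩
    obtain ⟨f, -, rfl⟩ := AddSubgroup.mem_map.mp ha
    rw [apply_sub_smul_left b σ hσσ hσb, hker, map_zero]
  · rintro ⟨ht, hann⟩
    refine ⟨ht, ?_⟩
    have hmem : (σ - s • AddMonoidHom.id L) t ∈ Htr := by
      rw [AddMonoidHom.sub_apply, AddMonoidHom.smul_apply, AddMonoidHom.id_apply]
      exact Htr.sub_mem (hσt t ht) (Htr.zsmul_mem ht s)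
    refine eq_zero_of_mem_of_forall_mem' b hsymm hcod hHtr hinj hmem fun f hf ↦ ?_
    rw [← apply_sub_smul_left b σ hσσ hσb]
    exact hann _ (AddSubgroup.mem_map.mpr ⟨f, hf, rfl⟩)

include hn hsymm hcod hHf hHtr hσσ hσb hσf hσt in
/-- **SIGNED EIGEN-COUNT: `#(H_tr ∩ ker(σ − s)) = #(H_f ∩ ker(σ − s))`** (see the module docstring).
[cite: MazurRubin2004, §1.3] [cite: MilneADT2006, Ch. I §0 (0.19)] -/
theorem natCard_inf_ker_eq_of_lagrangian_pair [Finite L] [NeZero n] (hinj : Injective b) (s : ℤ) :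
    Nat.card ↥(Htr ⊓ (σ - s • AddMonoidHom.id L).ker) = Nat.card ↥(Hf ⊓ (σ - s • AddMonoidHom.id L).ker) := by
  set δ : L →+ L := σ - s • AddMonoidHom.id L with hδ
  have hA' : Hf.map δ ≤ Hf := by
    rintro _ ⟨f, hf, rfl⟩
    rw [hδ, AddMonoidHom.sub_apply, AddMonoidHom.smul_apply, AddMonoidHom.id_apply]
    exact Hf.sub_mem (hσf f hf) (Hf.zsmul_mem hf s)
  have h1 : Nat.card ↥(Htr ⊓ ⨅ a ∈ Hf.map δ, (b a).ker) * Nat.card ↥(Hf.map δ) = Nat.card Htr :=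
    natCard_ann_mul_natCard b hn hsymm hcod hHf hHtr hinj (Hf.map δ) hA'
  have h2 : Nat.card Hf = Nat.card ↥(Hf ⊓ δ.ker) * Nat.card ↥(Hf.map δ) := card_eq_card_inf_ker_mul_card_map δ Hf
  have h3 : Nat.card Hf = Nat.card Htr := natCard_eq_of_lagrangian_pair b hn hsymm hcod hHf hHtr hinj
  rw [← inf_ker_eq_ann_map b hsymm hcod hHtr σ hσσ hσb hσt hinj s, ← h3, h2] at h1
  exact Nat.eq_of_mul_eq_mul_right (Nat.card_pos (α := ↥(Hf.map δ))) h1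

end EigenCount

/-! ### Counting inside a `2`-power-torsion subgroup -/

/-- **`#H ≤ 2^(m+κ)` with a class `x` of order `2^m` ⟹ `2^κ · H ⊆ ℤ x`**, for a subgroup `H` killed by `2^k` (any `k`): the quotient
`H/ℤx` has `≤ 2^κ` elements and the class of `y` has `2`-power order. g13's `forall_exists_zsmul_eq_of_natCard_le` is the case `k = m`.
[cite: MazurRubin2004, §4.1 Cor. 4.1.9] -/
theorem forall_exists_zsmul_eq_of_natCard_le_of_nsmul_eq_zero {G : Type*} [AddCommGroup G] (H : AddSubgroup G) [Finite H]
    (k m κ : ℕ) (hH : ∀ y ∈ H, (2 ^ k : ℕ) • y = 0) {x : G} (hx : x ∈ H) (hordx : addOrderOf x = 2 ^ m)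
    (hcard : Nat.card H ≤ 2 ^ (m + κ)) :
    ∀ y ∈ H, ∃ t : ℤ, ((2 ^ κ : ℕ) : ℤ) • y = t • x := by
  intro y hy
  set x' : H := ⟨x, hx⟩ with hx'
  set y' : H := ⟨y, hy⟩ with hy'
  set Z : AddSubgroup H := AddSubgroup.zmultiples x' with hZ
  have hordx' : addOrderOf x' = 2 ^ m := by
    rw [← AddSubgroup.addOrderOf_coe x']; exact hordx
  have hcardZ : Nat.card Z = 2 ^ m := by rw [hZ, Nat.card_zmultiples, hordx']
  have hHQ : Nat.card H = Nat.card (H ⧸ Z) * Nat.card Z := AddSubgroup.card_eq_card_quotient_mul_card_addSubgroup Z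
  have hQ : Nat.card (H ⧸ Z) ≤ 2 ^ κ := by
    have h2m : 0 < 2 ^ m := Nat.pos_of_ne_zero (pow_ne_zero m two_ne_zero)
    have : Nat.card (H ⧸ Z) * 2 ^ m ≤ 2 ^ κ * 2 ^ m := by
      rw [← hcardZ, ← hHQ, hcardZ, ← pow_add, add_comm]; exact hcard
    exact Nat.le_of_mul_le_mul_right this h2m
  haveI : Finite (H ⧸ Z) := inferInstance
  set q : H ⧸ Z := (y' : H ⧸ Z) with hq
  have hq2k : (2 ^ k) • q = 0 := by
    rw [hq, ← QuotientAddGroup.mk_nsmul]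
    have : (2 ^ k) • y' = 0 := Subtype.ext (by rw [AddSubgroupClass.coe_nsmul, hH y hy]; rfl)
    rw [this, QuotientAddGroup.mk_zero]
  obtain ⟨i, -, hi⟩ := (Nat.dvd_prime_pow Nat.prime_two).mp (addOrderOf_dvd_of_nsmul_eq_zero hq2k)
  have hile : 2 ^ i ≤ 2 ^ κ :=
    (hi ▸ Nat.le_of_dvd Nat.card_pos (addOrderOf_dvd_natCard q)).trans hQ
  have hiκ : i ≤ κ := (Nat.pow_le_pow_iff_right (by norm_num)).mp hile
  have hqκ : (2 ^ κ) • q = 0 := by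
    apply addOrderOf_dvd_iff_nsmul_eq_zero.mp
    rw [hi]; exact Nat.pow_dvd_pow 2 hiκ
  have hmem : (2 ^ κ) • y' ∈ Z := by
    rw [← QuotientAddGroup.eq_zero_iff, QuotientAddGroup.mk_nsmul]; exact hqκ
  obtain ⟨t, ht⟩ := AddSubgroup.mem_zmultiples_iff.mp hmem
  refine ⟨t, ?_⟩
  have h := congrArg Subtype.val ht
  simp only [AddSubgroupClass.coe_zsmul, AddSubgroupClass.coe_nsmul] at h
  rw [natCast_zsmul]
  exact h.symm

/-- If `2^k x = 0`, `2^(k − c) x ≠ 0` and `b x = 0` then `2^(k − c + 1) ∣ b` (the order of `x` is a power of `2` exceeding `2^(k−c)`).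
[folklore] -/
theorem two_pow_dvd_of_zsmul_eq_zero_of_ne_zero {G : Type*} [AddCommGroup G] {x : G} {k c : ℕ}
    (hk : (2 : ℤ) ^ k • x = 0) (hne : (2 : ℤ) ^ (k - c) • x ≠ 0) {b : ℤ} (hb : b • x = 0) :
    (2 : ℤ) ^ (k - c + 1) ∣ b := by
  have hk' : (2 ^ k) • x = 0 := by rw [← natCast_zsmul, Nat.cast_pow, Nat.cast_ofNat]; exact hk
  obtain ⟨m, -, hm⟩ := (Nat.dvd_prime_pow Nat.prime_two).mp (addOrderOf_dvd_of_nsmul_eq_zero hk')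
  -- `m > k - c`
  have hmc : k - c + 1 ≤ m := by
    by_contra hlt
    apply hne
    have hle : m ≤ k - c := by omega
    have h1 : (2 ^ m) • x = 0 := by rw [← hm]; exact addOrderOf_nsmul_eq_zero x
    have h2 : (2 : ℤ) ^ (k - c) = (2 : ℤ) ^ (k - c - m) * (2 ^ m : ℕ) := by
      rw [Nat.cast_pow, Nat.cast_ofNat, ← pow_add, Nat.sub_add_cancel hle]
    rw [h2, mul_smul, natCast_zsmul, h1, smul_zero]
  have hdvd : (addOrderOf x : ℤ) ∣ b := addOrderOf_dvd_iff_zsmul_eq_zero.mpr hb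
  rw [hm, Nat.cast_pow, Nat.cast_ofNat] at hdvd
  exact (pow_dvd_pow 2 hmc).trans hdvd

/-- `2^(c+d) • y − (2^d * t) • x = 2^d • (2^c • y − t • x)` (generic spelling, safe for `rw` on `H¹(K, E[2^M])`). [folklore] -/
theorem zsmul_sub_zsmul_mul_eq {G : Type*} [AddCommGroup G] (c d : ℕ) (t : ℤ) (x y : G) :
    (2 : ℤ) ^ (c + d) • y - ((2 : ℤ) ^ d * t) • x = (2 : ℤ) ^ d • ((2 : ℤ) ^ c • y - t • x) := by
  rw [smul_sub, smul_smul, smul_smul, ← pow_add, add_comm]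

end Summit.BirchSwinnertonDyer.BirchSwinnertonDyer.Theorems.KolyvaginAtTwo.RegularRefill

end
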